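import Summits.QuantumAdvantage.QuantumAdvantage.Theorems.CubicForrelationNearExactIsExactCubicFormBalanced
import Mathlib.Combinatorics.Pigeonhole

/-!
# Crux `CubicForrelation.NearExactIsExact` (stmt-QuantumAdvantage-14043) — E1280-even, R4 branch, descendant `0` (`HZ`): two subgroups of
  `𝔽₂⁷` of order `32` meet in at least `8` elements

Certificate seat `b2b-cforr-cert` (gen 43).  HONEST FRAMING: kernel-checked counting lemma (standard axioms) used in the two-flat case of
the descendant `t̄₇ = 0` (R4-PARTNER §4, `w = 2`): the radicals of two rank-`2` alternating forms on `𝔽₂⁷` (each of size `32`,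
…CubicFormR4ZQuad `tq0_rad32`) share at least `8` vectors, because the fibres of `(x, y) ↦ x ⊕ y` on `U × V` have the size of `U ∩ V`
(`tq0_inter8`, via the pigeonhole principle: `32·32 > 7·128`).  Nothing about `θ₁₂`; NOT summit progress.

References: this seat lineage (g37 R4-PARTNER §4, g43 LEAN-GEN43).  Axioms: the standard three.
-/

set_option linter.dupNamespace false -- D-0017: single-problem summit ⇒ `QuantumAdvantage.QuantumAdvantage` by design

namespace Summit.QuantumAdvantage.QuantumAdvantage.Theorems.CubicForrelation.NearExactIsExact

open Finset
open Literature.Computability.QuantumComplexity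
open Literature.Computability.QuantumComplexity.BuzetChailloux (bxor zeroVec bxor_comm bxor_self bxor_zeroVec zeroVec_bxor
  bxor_bxor_cancel_left)

/-- **Two `⊕`-closed sets of `32` vectors in `𝔽₂⁷` meet in at least `8` vectors.** [folklore] -/
theorem tq0_inter8 (U V : Finset (Fin 7 → Bool))
    (hU : ∀ x ∈ U, ∀ y ∈ U, bxor x y ∈ U) (hV : ∀ x ∈ V, ∀ y ∈ V, bxor x y ∈ V)
    (hcU : #U = 32) (hcV : #V = 32) : 8 ≤ #(U ∩ V) := by
  classical
  -- a large fibre of `(x, y) ↦ x ⊕ y` on `U × V`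
  have hmaps : ∀ p ∈ U ×ˢ V, (fun p : (Fin 7 → Bool) × (Fin 7 → Bool) => bxor p.1 p.2) p ∈ (univ : Finset (Fin 7 → Bool)) :=
    fun p _ => mem_univ _
  have hbig : #(univ : Finset (Fin 7 → Bool)) * 7 < #(U ×ˢ V) := by
    rw [card_univ, Fintype.card_fun, Fintype.card_bool, Fintype.card_fin, card_product, hcU, hcV]
    norm_num
  obtain ⟨t, -, ht⟩ := exists_lt_card_fiber_of_mul_lt_card_of_maps_to hmaps hbig
  set F := (U ×ˢ V).filter (fun p => bxor p.1 p.2 = t) with hF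
  -- pick one element of the fibre
  have hFne : F.Nonempty := by rw [← card_pos]; omega
  obtain ⟨p₀, hp₀⟩ := hFne
  rw [hF, mem_filter, mem_product] at hp₀
  obtain ⟨⟨hp₀U, hp₀V⟩, hp₀t⟩ := hp₀
  -- the injection `(x, y) ↦ x ⊕ x₀` from the fibre into `U ∩ V`
  have hinj : Set.InjOn (fun p : (Fin 7 → Bool) × (Fin 7 → Bool) => bxor p.1 p₀.1) F := by
    intro p hp q hq hpq
    rw [hF, mem_coe, mem_filter, mem_product] at hp hq
    have h1 : p.1 = q.1 := by
      have hpq' : bxor p.1 p₀.1 = bxor q.1 p₀.1 := hpq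
      have e1 : bxor (bxor p.1 p₀.1) p₀.1 = bxor (bxor q.1 p₀.1) p₀.1 := by rw [hpq']
      rwa [iw_bxor_assoc, bxor_self, bxor_zeroVec, iw_bxor_assoc, bxor_self, bxor_zeroVec] at e1
    have h2 : p.2 = q.2 := by
      have ep := hp.2; have eq := hq.2
      rw [← eq, h1] at ep
      have e2 : bxor q.1 (bxor q.1 p.2) = bxor q.1 (bxor q.1 q.2) := by rw [ep]
      rwa [← iw_bxor_assoc, bxor_self, zeroVec_bxor, ← iw_bxor_assoc, bxor_self, zeroVec_bxor] at e2
    exact Prod.ext h1 h2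
  have hto : ∀ p ∈ F, (fun p : (Fin 7 → Bool) × (Fin 7 → Bool) => bxor p.1 p₀.1) p ∈ U ∩ V := by
    intro p hp
    rw [hF, mem_filter, mem_product] at hp
    rw [mem_inter]
    refine ⟨hU _ hp.1.1 _ hp₀U, ?_⟩
    -- `x ⊕ x₀ = y ⊕ y₀` since `x ⊕ y = t = x₀ ⊕ y₀`
    have e : bxor p.1 p₀.1 = bxor p.2 p₀.2 := by
      have h1 := hp.2; have h2 := hp₀t
      have : bxor (bxor p.1 p.2) (bxor p₀.1 p₀.2) = zeroVec := by rw [h1, h2, bxor_self]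
      funext i
      have := congrFun this i
      simp only [bxor, zeroVec] at this ⊢
      revert this; cases p.1 i <;> cases p.2 i <;> cases p₀.1 i <;> cases p₀.2 i <;> decide
    show bxor p.1 p₀.1 ∈ V
    rw [e]
    exact hV _ hp.1.2 _ hp₀V
  have hle := card_le_card_of_injOn _ hto hinj
  omega

end Summit.QuantumAdvantage.QuantumAdvantage.Theorems.CubicForrelation.NearExactIsExact
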